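import Summits.CriticalPhenomena.PercolationContinuityZ3.Theorems.PercNearOneGluingNoHeavyLowerTailSahiThreeCopyCellX6aMasks1
import Summits.CriticalPhenomena.PercolationContinuityZ3.Theorems.PercNearOneGluingNoHeavyLowerTailSahiThreeCopyHitPairsSix

/-!
# `NoHeavyLowerTail` (crux stmt-CriticalPhenomena-4575), Sahi programme: ★★★ **`LawGood 6 π 1_{X6a}` AT EVERY FRONT PROFILE**

Support file (Sahi cell, seat `prim-sahi-p1`, generation 65; `--supports stmt-CriticalPhenomena-4575`).  Assembly: the interior table (masks `prof6 m`,
`…CellX6aMasks*`) and the boundary (up-set sections on five coordinates, `frontGood_six_of_boundary`).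
COMPUTATIONAL content inherited (cell checks, section identities). [this work]
-/

namespace Summit.CriticalPhenomena.PercolationContinuityZ3.Theorems.SahiThreeCopy

open Finset Function Literature.Combinatorics.Sahi2008
open scoped BigOperators

/-- ★★ `LawGood 6 (prof6 m) 1_{X6a}` for EVERY interior front profile (all 64 masks). [this work] -/
theorem lawGood_X6a_prof (m : Fin 64) : LawGood 6 (prof6 m) (setInd X6aSet) := by
  fin_cases m
  · exact lawGood_X6a111111
  · exact lawGood_X6am1
  · exact lawGood_X6a121111
  · exact lawGood_X6a221111
  · exact lawGood_X6am4
  · exact lawGood_X6am5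
  · exact lawGood_X6am6
  · exact lawGood_X6am7
  · exact lawGood_X6am8
  · exact lawGood_X6am9
  · exact lawGood_X6am10
  · exact lawGood_X6am11
  · exact lawGood_X6am12
  · exact lawGood_X6am13
  · exact lawGood_X6am14
  · exact lawGood_X6am15
  · exact lawGood_X6am16
  · exact lawGood_X6am17
  · exact lawGood_X6am18
  · exact lawGood_X6am19
  · exact lawGood_X6am20
  · exact lawGood_X6am21
  · exact lawGood_X6am22
  · exact lawGood_X6am23
  · exact lawGood_X6am24
  · exact lawGood_X6am25
  · exact lawGood_X6am26
  · exact lawGood_X6am27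
  · exact lawGood_X6am28
  · exact lawGood_X6am29
  · exact lawGood_X6am30
  · exact lawGood_X6am31
  · exact lawGood_X6a111112
  · exact lawGood_X6am33
  · exact lawGood_X6a121112
  · exact lawGood_X6a221112
  · exact lawGood_X6am36
  · exact lawGood_X6am37
  · exact lawGood_X6am38
  · exact lawGood_X6am39
  · exact lawGood_X6a111212
  · exact lawGood_X6am41
  · exact lawGood_X6a121212
  · exact lawGood_X6a221212
  · exact lawGood_X6am44
  · exact lawGood_X6am45
  · exact lawGood_X6am46
  · exact lawGood_X6am47
  · exact lawGood_X6a111122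
  · exact lawGood_X6am49
  · exact lawGood_X6a121122
  · exact lawGood_X6a221122
  · exact lawGood_X6am52
  · exact lawGood_X6am53
  · exact lawGood_X6am54
  · exact lawGood_X6am55
  · exact lawGood_X6a111222
  · exact lawGood_X6am57
  · exact lawGood_X6a121222
  · exact lawGood_X6a221222
  · exact lawGood_X6a112222
  · exact lawGood_X6am61
  · exact lawGood_X6a122222
  · exact lawGood_X6a222222

/-- ★★★ **`LawGood 6 π 1_{X6a}` at EVERY front profile** (interior: the table; boundary: sections are up-sets on five coordinates). [this work] -/
theorem lawGood_X6a_all (π : Fin 6 → ℕ) : LawGood 6 π (setInd X6aSet) :=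
  lawGood_all_of_interior_of_boundary (k := 6) (f := setInd X6aSet)
    (fun m hm => lawGood_X6a_prof ⟨m, hm⟩)
    (fun π i hi => lawGood_of_frontGood (frontGood_six_of_boundary π i hi isUpperSet_X6aSet)) π

end Summit.CriticalPhenomena.PercolationContinuityZ3.Theorems.SahiThreeCopy
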